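import Mathlib.LinearAlgebra.Matrix.Adjugate
import Mathlib.LinearAlgebra.Matrix.Symmetric
import Mathlib.LinearAlgebra.Matrix.Trace
import Mathlib.Data.Real.Basic
import Mathlib.Tactic.LinearCombination
import Summits.NavierStokesRegularity.NavierStokesRegularity.Theses.IsobarTomography

/-!
# Route IsobarTomography — `GaussKroneckerSplit` (item stmt-NavierStokesRegularity-11743)

The polynomial identity behind the isobar Gauss–Bonnet budget (GB) of the route: for a symmetric
real `3 × 3` matrix `M` and a unit vector `n`,

`2 · nᵀ adj(M) n = (tr M − nᵀ M n)² − |M|²_F + 2 |M n|² − (nᵀ M n)²`.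

With `M = ∇²p`, `n = ∇p/|∇p|` the left side is `2 K_Σ |∇p|²` (Goldman 2005, level-set Gauss
curvature `K_Σ = ∇pᵀ adj(∇²p) ∇p / |∇p|⁴`).

Proof: we first prove the HOMOGENISED identity, valid for every `n` (no normalisation), with
`s := n ⬝ᵥ n`:

`s · 2 nᵀ adj(M) n = (s · tr M − nᵀ M n)² − s² |M|²_F + 2 s |M n|² − (nᵀ M n)²`,

by expanding all `Fin 3` sums and the cofactor formula `Matrix.adjugate_fin_three`, rewriting the
three sub-diagonal entries by symmetry, and closing with `ring`; the item is the specialisation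
`s = 1`. Symmetry of `M` is necessary (the planner's numerics; e.g. a nilpotent Jordan block fails).
-/

namespace Summit.NavierStokesRegularity.NavierStokesRegularity.Theorems

open Matrix

/-- **Homogenised Gauss–Kronecker split.** For a symmetric real `3 × 3` matrix `M` and ANY vector
`n` (not necessarily a unit vector), with `s = n ⬝ᵥ n`:
`s · (2 · nᵀ adj(M) n) = (s · tr M − nᵀ M n)² − s² · ∑ᵢⱼ Mᵢⱼ² + 2 s · |M n|² − (nᵀ M n)²`.
Both sides are homogeneous of degree 4 in `n` and degree 2 in `M`; proved by brute-force expansion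
over `Fin 3` (`Matrix.adjugate_fin_three`) and `ring`. -/
theorem gaussKroneckerSplit_homog (M : Matrix (Fin 3) (Fin 3) ℝ) (hM : M.IsSymm)
    (n : Fin 3 → ℝ) :
    (n ⬝ᵥ n) * (2 * (n ⬝ᵥ (M.adjugate *ᵥ n))) =
      ((n ⬝ᵥ n) * M.trace - n ⬝ᵥ (M *ᵥ n)) ^ 2 - (n ⬝ᵥ n) ^ 2 * (∑ i, ∑ j, M i j ^ 2)
        + 2 * (n ⬝ᵥ n) * ((M *ᵥ n) ⬝ᵥ (M *ᵥ n)) - (n ⬝ᵥ (M *ᵥ n)) ^ 2 := by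
  have h10 : M 1 0 = M 0 1 := hM.apply 0 1
  have h20 : M 2 0 = M 0 2 := hM.apply 0 2
  have h21 : M 2 1 = M 1 2 := hM.apply 1 2
  simp only [Matrix.adjugate_fin_three, Matrix.mulVec, dotProduct, Matrix.trace, Matrix.diag,
    Fin.sum_univ_three, Matrix.of_apply, Matrix.cons_val, h10, h20, h21]
  ring

/-- **Item stmt-NavierStokesRegularity-11743 (`GaussKroneckerSplit`), route IsobarTomography.**
For a symmetric real `3 × 3` matrix `M` and a unit vector `n` (`n ⬝ᵥ n = 1`):
`2 · nᵀ adj(M) n = (tr M − nᵀ M n)² − ∑ᵢⱼ Mᵢⱼ² + 2 |M n|² − (nᵀ M n)²`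
(Goldman 2005, doi:10.1016/j.cagd.2005.06.005, for the curvature interpretation). The
specialisation `n ⬝ᵥ n = 1` of `gaussKroneckerSplit_homog`. -/
theorem gaussKroneckerSplit_proof :
    Summit.NavierStokesRegularity.NavierStokesRegularity.Theses.IsobarTomography.GaussKroneckerSplit := by
  unfold Summit.NavierStokesRegularity.NavierStokesRegularity.Theses.IsobarTomography.GaussKroneckerSplit
  intro M hM n hn
  have h := gaussKroneckerSplit_homog M hM n
  rw [hn] at h
  linear_combination h

end Summit.NavierStokesRegularity.NavierStokesRegularity.Theorems
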